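import Summits.Ventures.PercRepro.S2ThirteenSevenCell
import Summits.Ventures.PercRepro.S1PoorCapThirteenSix

/-!
# PercRepro — S2: THE CELL `(13, 7)`, UNCONDITIONAL (p7, gen 17; sub-claim S2; the second cell of the row `p = 13`)

p1 g34's `S1.ncard_fiveCircuits_le_one_forty_six_thirteen_seven` (S1PoorCapThirteenSix, unconditional: `s₅ ≤ 146` on every
coloop-free spread `e`-free core of rank `13` on `20` points) discharges the cap of `c025_thirteen_seven_cf_spread_of_cap`, so the
coloop-free spread case of `(13, 7)` is a theorem (**`c025_thirteen_seven_cf_spread`**), the coloop-free cell is a theorem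
(**`c025_thirteen_seven_cf`**, with the cases `ν = 6, 5, 4` of S2ThirteenSevenNuFive / NuFour) and, through the double coloop
split with both sub-cells (S2TwelveSevenK1NuFour, S2ElevenSevenK2NuFour), **`c025_core_five_thirteen_seven (M) [M.Finite]
(hR : eRank = 13) (hn : |E| = 13 + 7) (hfree) : RLS M 13 5`** — THE CELL `(13, 7)` on every `e`-free core of rank `13` on `20`
points. The window move is the lead's; nothing beyond the statement is claimed. Axioms: standard.
-/

open scoped Matroid

namespace PercRepro

namespace ThmN

open Set

variable {α : Type}

/-- **The coloop-free spread case of the cell `(13, 7)`, unconditional** (p1's `s₅ ≤ 146` in the tree). -/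
theorem c025_thirteen_seven_cf_spread (M : Matroid α) [M.Finite]
    (hR : M.eRank = ((13 : ℕ) : ℕ∞)) (hn : M.E.ncard = 13 + 7)
    (hfree : ∀ e ∈ M.E, ∃ A ⊆ M.E \ {e}, e ∉ M.closure A ∧ e ∉ M.closure ((M.E \ {e}) \ A)) (hK : ∀ e, ¬ M.IsColoop e)
    (h4 : ¬ ∃ W ⊆ M.E, W.ncard ≤ 9 ∧ W.encard = M.eRk W + 4) : RLS M 13 5 := by
  have hd : M.E.encard = M.eRank + 7 := by
    rw [hR, ← M.ground_finite.cast_ncard_eq, hn]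
    push_cast
    ring
  exact c025_thirteen_seven_cf_spread_of_cap M hR hn hfree hK h4
    (S1.ncard_fiveCircuits_le_one_forty_six_thirteen_seven M hfree h4 hd hn hK)

/-- **The coloop-free cell `(13, 7)`, unconditional.** -/
theorem c025_thirteen_seven_cf (M : Matroid α) [M.Finite]
    (hR : M.eRank = ((13 : ℕ) : ℕ∞)) (hn : M.E.ncard = 13 + 7)
    (hfree : ∀ e ∈ M.E, ∃ A ⊆ M.E \ {e}, e ∉ M.closure A ∧ e ∉ M.closure ((M.E \ {e}) \ A)) (hK : ∀ e, ¬ M.IsColoop e) :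
    RLS M 13 5 :=
  c025_thirteen_seven_cf_of_spread
    (fun M' _ hR' hn' hfree' hK' h4' => c025_thirteen_seven_cf_spread M' hR' hn' hfree' hK' h4') M hR hn hfree hK

/-- **THE CELL `(13, 7)`**: `RLS M 13 5` on every `e`-free core of rank `13` on `20` points. -/
theorem c025_core_five_thirteen_seven (M : Matroid α) [M.Finite]
    (hR : M.eRank = ((13 : ℕ) : ℕ∞)) (hn : M.E.ncard = 13 + 7)
    (hfree : ∀ e ∈ M.E, ∃ A ⊆ M.E \ {e}, e ∉ M.closure A ∧ e ∉ M.closure ((M.E \ {e}) \ A)) : RLS M 13 5 :=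
  c025_core_five_thirteen_seven_of_spread
    (fun M' _ hR' hn' hfree' hK' h4' => c025_thirteen_seven_cf_spread M' hR' hn' hfree' hK' h4') M hR hn hfree

end ThmN

end PercRepro
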